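import Summits.NavierStokesRegularity.NavierStokesRegularity.Theses.SymmetryModuliCount
import Literature.Analysis.FluidPDE.TypeIAncientMild
import Literature.Analysis.FluidPDE.LocalTypeI
import Summits.NavierStokesRegularity.NavierStokesRegularity.Theorems.SymmetryModuliCountForcedSymmetryStubBlowDownDriver

/-!
# `ForcedSymmetry` (stmt-NavierStokesRegularity-4052), line `blow-down-census`: blow-down limits are singular

Route `SymmetryModuliCount`. A corollary of the landed general blow-down driver
(`ForcedSymmetry.BlowDownCensus.stub_blowDownDriver`, p96980) recorded for the planners and the disprover: the smooth
blow-down limit `W ∈ A_C` of a NONZERO element of `A_C ∩ 𝒦_K` is SINGULAR at the space–time origin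
(`IsBackwardSingularPoint W 0`: essentially unbounded on every backward parabolic ball `Q(0, r)`), because it agrees
a.e. near the vertex with the `L³` limit, which is singular by persistence of singularities (Albritton–Barker 2019,
Prop. 2.3). So, inside the ledger class, `¬X` produces a Type-I KNSS-mild ancient field with a genuine (Type-I)
singularity at `(0, 0)` — the object every blow-down / tangent-flow argument of the line acts on, and the object the
line's X-strength stub `stub_blowDownLimitSelfSimilar` claims to be self-similar.

* `exists_singular_limit_of_parts` — with the cubic bound and the pressure package as hypotheses (the driver's inputs).

References: D. Albritton, T. Barker, ARMA 232 (2019) = arXiv:1811.00502, Lemma 2.2, Prop. 2.3, §3 [AlbrittonBarker2019].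
-/

noncomputable section

-- the summit and its single problem share the name `NavierStokesRegularity` (D-0017 nested layout)
set_option linter.dupNamespace false

open MeasureTheory Set Function Filter Topology TopologicalSpace Metric
open scoped NNReal ENNReal

namespace Summit.NavierStokesRegularity.NavierStokesRegularity.Theorems.ForcedSymmetry.BlowDownCensus

open Literature.Analysis.FluidPDE

/-- **Blow-down limits of nonzero elements are singular at the vertex.** Given the uniform cubic bound and the
pressure package for the class `A_C ∩ {ledger K}` (the inputs of the landed driver), an element `v` with ledger `K`
and `v(t₀, x₀) ≠ 0`, `t₀ < 0`, has a blow-down limit `W ∈ A_C` — slice-wise pointwise limit of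
`c_k v(t₁ + c_k² s, x₁ + c_k y)`, `c_k → ∞` — which is singular at the space–time origin. Proof: the driver's `L³`
limit `U` is singular at `0` (persistence, A–B Prop. 2.3) and `U = W` a.e. on `Q(0, ½)`; for `r ≤ ½` the two
`L^∞(Q(0,r))` norms agree, for `r > ½` monotonicity. [cite: AlbrittonBarker2019, Prop. 2.3 and §3] -/
theorem exists_singular_limit_of_parts :
    ∀ (C K D₀ : ℝ),
    (∀ w : ℝ → EuclideanSpace ℝ (Fin 3) → EuclideanSpace ℝ (Fin 3), IsTypeIAncientMild C w →
      (∀ t < 0, ∀ (x₀ : EuclideanSpace ℝ (Fin 3)) (R : ℝ), 0 < R →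
        ∫ x in ball x₀ R, ‖w t x‖ ^ 2 ≤ K * R) →
      ∫⁻ z in parabolicCylinder 1 (0 : ℝ × EuclideanSpace ℝ (Fin 3)), ‖w z.1 z.2‖ₑ ^ (3 : ℕ) ≤
        ENNReal.ofReal (2 * C * K)) →
    (∀ w : ℝ → EuclideanSpace ℝ (Fin 3) → EuclideanSpace ℝ (Fin 3), IsTypeIAncientMild C w →
      (∀ t < 0, ∀ (x₀ : EuclideanSpace ℝ (Fin 3)) (R : ℝ), 0 < R →
        ∫ x in ball x₀ R, ‖w t x‖ ^ 2 ≤ K * R) →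
      ∀ T ∈ Ioc (0 : ℝ) 1, ∃ q : ℝ → EuclideanSpace ℝ (Fin 3) → ℝ,
        IsSuitableWeakSolutionInBall 1 0 (fun s y => w (s - T) y) q ∧
        ∫⁻ z in parabolicCylinder 1 (0 : ℝ × EuclideanSpace ℝ (Fin 3)), ‖q z.1 z.2‖ₑ ^ (3 / 2 : ℝ) ≤
          ENNReal.ofReal D₀) →
    ∀ (v : ℝ → EuclideanSpace ℝ (Fin 3) → EuclideanSpace ℝ (Fin 3)), IsTypeIAncientMild C v →
      (∀ t < 0, ∀ (x₀ : EuclideanSpace ℝ (Fin 3)) (R : ℝ), 0 < R →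
        ∫ x in ball x₀ R, ‖v t x‖ ^ 2 ≤ K * R) →
      ∀ (t₀ : ℝ) (x₀ : EuclideanSpace ℝ (Fin 3)), t₀ < 0 → v t₀ x₀ ≠ 0 →
      ∃ (t₁ : ℝ) (x₁ : EuclideanSpace ℝ (Fin 3)) (c : ℕ → ℝ)
        (W : ℝ → EuclideanSpace ℝ (Fin 3) → EuclideanSpace ℝ (Fin 3)),
        t₁ < 0 ∧ (∀ k, 0 < c k) ∧ Tendsto c atTop atTop ∧ IsTypeIAncientMild C W ∧
        (∀ s < 0, ∀ y, Tendsto (fun k => c k • v (t₁ + c k ^ 2 * s) (x₁ + c k • y)) atTop (𝓝 (W s y))) ∧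
        IsBackwardSingularPoint W 0 := by
  intro C K D₀ hcubic hPress v hv hKv t₀ x₀ ht₀ hne
  obtain ⟨t₁, x₁, c, U, W, ht₁, hcpos, hctop, hW, hpt, -, hsing, hUW⟩ :=
    stub_blowDownDriver C K D₀ hcubic hPress v hv hKv t₀ x₀ ht₀ hne
  refine ⟨t₁, x₁, c, W, ht₁, hcpos, hctop, hW, hpt, fun r hr => ?_⟩
  -- `L^∞` norms on `Q(0, min r ½)`: `U = W` a.e. there, and `U` is singular
  set ρ : ℝ := min r (1 / 2) with hρ
  have hρ0 : 0 < ρ := lt_min hr (by norm_num)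
  have hρr : ρ ≤ r := min_le_left _ _
  have hρh : ρ ≤ 1 / 2 := min_le_right _ _
  have hsub : parabolicCylinder ρ (0 : ℝ × EuclideanSpace ℝ (Fin 3)) ⊆
      parabolicCylinder (1 / 2) (0 : ℝ × EuclideanSpace ℝ (Fin 3)) :=
    parabolicCylinder_mono hρ0.le hρh 0
  have hsubr : parabolicCylinder ρ (0 : ℝ × EuclideanSpace ℝ (Fin 3)) ⊆
      parabolicCylinder r (0 : ℝ × EuclideanSpace ℝ (Fin 3)) :=
    parabolicCylinder_mono hρ0.le hρr 0
  have hUWρ : uncurry U =ᵐ[volume.restrict (parabolicCylinder ρ (0 : ℝ × EuclideanSpace ℝ (Fin 3)))] uncurry W :=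
    ae_restrict_of_ae_restrict_of_subset hsub hUW
  have hUρ : eLpNorm (uncurry U) ∞ (volume.restrict (parabolicCylinder ρ (0 : ℝ × EuclideanSpace ℝ (Fin 3)))) = ∞ :=
    hsing ρ hρ0
  rw [eLpNorm_congr_ae hUWρ] at hUρ
  have h1 : eLpNorm (uncurry W) ∞ (volume.restrict (parabolicCylinder ρ (0 : ℝ × EuclideanSpace ℝ (Fin 3)))) ≤
      eLpNorm (uncurry W) ∞ (volume.restrict (parabolicCylinder r (0 : ℝ × EuclideanSpace ℝ (Fin 3)))) :=
    eLpNorm_mono_measure (uncurry W) (Measure.restrict_mono hsubr le_rfl)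
  rw [hUρ] at h1
  exact eq_top_iff.2 h1

end Summit.NavierStokesRegularity.NavierStokesRegularity.Theorems.ForcedSymmetry.BlowDownCensus

end
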